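import Literature.NumberTheory.Sieve.SmoothRieszMeanSaddle
import HarnessLib

/-!
# The saddle-point method on `Re s = α(x,y)` with an abstract slowly-varying kernel

Topic `Literature/NumberTheory/Sieve`; a PROVED tool file toward
`Literature.NumberTheory.DiophantineGeometry.XYZUpperHalf` ([Harper2016, Cor. 1], smoothed major
arcs). With `α = α(x,y)`, `φ = φ₂(α,y)`, `e(t)` the saddle exponent (`exp e(t) = ζ(α+it,y)x^{it}/ζ(α,y)`)
and an integrable kernel `A : ℝ → ℂ` (think `A(t) = 𝒜(α+it)` for a Mellin multiplier `𝒜`), put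
`f_A(t) = exp(e(t)) A(t)`. If `‖A(t)‖ ≤ B₀` (`|t| ≤ 3`), `‖A(t) − A(0)‖ ≤ B₁|t|` (`|t| ≤ 1`),
`‖A(t)‖ ≤ B_a` (all `t`) and `‖A(t)‖ ≤ B₃/|t|³` (`|t| > T`), then on the window `τ = 100/√φ` and
off it (given the decay of `ζ(α+it,y)/ζ(α,y)`: `≤ ε₁` on `π/log y ≤ |t| ≤ 3`, `≤ ε₂` on
`3 ≤ |t| ≤ T`) we get

`norm_kernelIntegral_sub_main_le`:
`‖∫ f_A − A(0)√(2π/φ)‖ ≤ (1475 B₀ log y + 4B₁)/φ + ‖A 0‖ e^{−φτ²/4}√(4π/φ)`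
`  + B₀ e^{−72}√(125π³/φ) + 10π ε₁ B₀/α + 2π ε₂ B_a T + 2π B₃/T²`.

Instances: `A(t) = Ŵ_λ(α+it)` (the principal major arc, `SmoothTwistedSaddle`), and
`A(t) = g^{−(α+it)} h_{q'}(α+it) Ŵ_λ(α+it)` (the principal parts of the arcs at `a/q`).

## References

* A. Hildebrand, G. Tenenbaum, Trans. AMS 296 (1986), §4 (Lemmas 10–11) [HildebrandTenenbaum1986].
* A. J. Harper, Compositio Math. 152 (2016), §5 [Harper2016].
-/

noncomputable section

open Real Complex MeasureTheory Set Filter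
open scoped Topology

namespace Literature.NumberTheory.Sieve

namespace SaddleKernel

/-! ### The integrand -/

/-- `f_A(t) = exp(e(t)) A(t)`. [cite: HildebrandTenenbaum1986, §4 (4.3)] -/
def kernelIntegrand (x α : ℝ) (y : ℕ) (A : ℝ → ℂ) (t : ℝ) : ℂ :=
  Complex.exp (saddleExponent x α y t) * A t

/-- `f_A` is continuous when `A` is. [folklore] -/
theorem continuous_kernelIntegrand {α : ℝ} (hα : 0 < α) (x : ℝ) (y : ℕ) {A : ℝ → ℂ} (hA : Continuous A) :
    Continuous (kernelIntegrand x α y A) := by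
  have h1 : Continuous fun t : ℝ => Complex.exp (saddleExponent x α y t) := by
    refine Complex.continuous_exp.comp (continuous_iff_continuousAt.2 fun t => ?_)
    have hre : 0 < ((α : ℂ) + (t : ℂ) * I).re := by simp [hα]
    exact ((hasDerivAt_saddleExponent (x := x) (y := y) hre).comp_ofReal).continuousAt
  exact h1.mul hA

/-- `‖f_A(t)‖ = (‖ζ(α+it,y)‖/ζ(α,y)) ‖A t‖ ≤ ‖A t‖`. [folklore] -/
theorem norm_kernelIntegrand_eq {α : ℝ} (hα : 0 < α) (x : ℝ) (y : ℕ) (A : ℝ → ℂ) (t : ℝ) :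
    ‖kernelIntegrand x α y A t‖ = ‖smoothZetaC ((α : ℂ) + t * I) y‖ / smoothZeta α y * ‖A t‖ := by
  rw [kernelIntegrand, norm_mul, norm_exp_saddleExponent hα x y t]

/-- `‖f_A(t)‖ ≤ ‖A t‖`. [folklore] -/
theorem norm_kernelIntegrand_le {α : ℝ} (hα : 0 < α) (x : ℝ) (y : ℕ) (A : ℝ → ℂ) (t : ℝ) :
    ‖kernelIntegrand x α y A t‖ ≤ ‖A t‖ := by
  rw [norm_kernelIntegrand_eq hα]
  have h1 : ‖smoothZetaC ((α : ℂ) + t * I) y‖ / smoothZeta α y ≤ 1 := by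
    rw [div_le_one (smoothZeta_pos hα)]; exact norm_smoothZetaC_le hα t y
  calc ‖smoothZetaC ((α : ℂ) + t * I) y‖ / smoothZeta α y * ‖A t‖ ≤ 1 * ‖A t‖ :=
        mul_le_mul_of_nonneg_right h1 (norm_nonneg _)
    _ = _ := one_mul _

/-- `f_A` is integrable when `A` is continuous and integrable. [folklore] -/
theorem integrable_kernelIntegrand {α : ℝ} (hα : 0 < α) (x : ℝ) (y : ℕ) {A : ℝ → ℂ} (hA : Continuous A)
    (hAi : Integrable A) : Integrable (kernelIntegrand x α y A) :=
  hAi.mono (continuous_kernelIntegrand hα x y hA).aestronglyMeasurable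
    (Eventually.of_forall fun t => norm_kernelIntegrand_le hα x y A t)

/-! ### Pointwise bound on the window -/

/-- **The window integrand**: for `|t| ≤ τ`, `13 τ³ log y φ ≤ 1`, `α = α(x,y) ∈ [3/5, 1]`, and a
kernel with `‖A t‖ ≤ B₀`, `‖A t − A 0‖ ≤ B₁ |t|`:
`‖f_A(t) − A(0) e^{−φt²/2}‖ ≤ e^{−φt²/2} (26 B₀ |t|³ log y φ + B₁ |t|)`.
[cite: HildebrandTenenbaum1986, §4 (4.5)–(4.6)] -/
theorem norm_window_integrand_sub_le {x τ t B₀ B₁ : ℝ} {y : ℕ} {A : ℝ → ℂ} (hx : 1 < x) (hy : 2 ≤ y)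
    (hα : 3 / 5 ≤ saddlePoint x y)
    (hη : 13 * τ ^ 3 * Real.log y * saddlePhi₂ (saddlePoint x y) y ≤ 1) (ht : |t| ≤ τ)
    (hB0 : ‖A t‖ ≤ B₀) (hB1 : ‖A t - A 0‖ ≤ B₁ * |t|) :
    ‖kernelIntegrand x (saddlePoint x y) y A t -
        A 0 * (Real.exp (-(saddlePhi₂ (saddlePoint x y) y / 2) * t ^ 2) : ℂ)‖ ≤
      Real.exp (-(saddlePhi₂ (saddlePoint x y) y / 2) * t ^ 2) *
        (26 * B₀ * |t| ^ 3 * Real.log y * saddlePhi₂ (saddlePoint x y) y + B₁ * |t|) := by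
  set α : ℝ := saddlePoint x y with hαdef
  have hα0 : 0 < α := by linarith
  set φ : ℝ := saddlePhi₂ α y with hφ
  have hφ0 : 0 ≤ φ := saddlePhi₂_nonneg α y
  have hlogy : 0 ≤ Real.log y := Real.log_nonneg (by exact_mod_cast le_trans one_le_two hy)
  have hτ0 : 0 ≤ τ := le_trans (abs_nonneg t) ht
  have hB00 : 0 ≤ B₀ := le_trans (norm_nonneg _) hB0
  -- `H(t) = e(t) + φ t²/2`, `‖H(t)‖ ≤ 13 |t|³ log y φ ≤ 1`
  set H : ℂ := saddleExponent x α y t + ((φ / 2 * t ^ 2 : ℝ) : ℂ) with hH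
  have hHb : ‖H‖ ≤ 13 * |t| ^ 3 * Real.log y * φ := by
    rcases eq_or_lt_of_le (abs_nonneg t) with h0 | hpos
    · have ht0 : t = 0 := abs_eq_zero.mp h0.symm
      rw [hH, ht0]
      simp [saddleExponent_zero]
    · exact norm_saddleExponent_add_le hx hy hα hpos le_rfl
  have hH1 : ‖H‖ ≤ 1 := by
    refine hHb.trans (le_trans ?_ hη)
    have : |t| ^ 3 ≤ τ ^ 3 := pow_le_pow_left₀ (abs_nonneg t) ht 3
    have h2 : 0 ≤ 13 * Real.log y * φ := by positivity
    nlinarith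
  -- `exp e(t) = e^{-φt²/2} exp H`
  have hexp : Complex.exp (saddleExponent x α y t) =
      (Real.exp (-(φ / 2) * t ^ 2) : ℂ) * Complex.exp H := by
    rw [hH, Complex.ofReal_exp, ← Complex.exp_add]
    congr 1
    push_cast; ring
  have hdec : kernelIntegrand x α y A t - A 0 * (Real.exp (-(φ / 2) * t ^ 2) : ℂ) =
      (Real.exp (-(φ / 2) * t ^ 2) : ℂ) * ((Complex.exp H - 1) * A t + (A t - A 0)) := by
    rw [kernelIntegrand, hexp]; ring
  rw [hdec, norm_mul, Complex.norm_real, Real.norm_eq_abs, abs_of_pos (Real.exp_pos _)]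
  apply mul_le_mul_of_nonneg_left _ (Real.exp_pos _).le
  have h1 : ‖Complex.exp H - 1‖ ≤ 2 * ‖H‖ := Complex.norm_exp_sub_one_le hH1
  calc ‖(Complex.exp H - 1) * A t + (A t - A 0)‖ ≤ ‖Complex.exp H - 1‖ * ‖A t‖ + ‖A t - A 0‖ := by
        rw [← norm_mul]; exact norm_add_le _ _
    _ ≤ (2 * (13 * |t| ^ 3 * Real.log y * φ)) * B₀ + B₁ * |t| :=
        add_le_add (mul_le_mul (h1.trans (by linarith)) hB0 (norm_nonneg _) (by positivity)) hB1
    _ = 26 * B₀ * |t| ^ 3 * Real.log y * φ + B₁ * |t| := by ring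

/-! ### Gaussian moment bounds -/

/-- `s e^{−c s²} ≤ 1/(2√c)` for `s ≥ 0`, `c > 0`. [folklore] -/
theorem mul_exp_neg_mul_sq_le (s : ℝ) {c : ℝ} (hc : 0 < c) :
    s * Real.exp (-c * s ^ 2) ≤ 1 / (2 * Real.sqrt c) := by
  have hsc : 0 < Real.sqrt c := Real.sqrt_pos.mpr hc
  have h1 : 2 * Real.sqrt c * s ≤ 1 + c * s ^ 2 := by
    have := Real.sq_sqrt hc.le
    nlinarith [sq_nonneg (Real.sqrt c * s - 1)]
  have h2 : 1 + c * s ^ 2 ≤ Real.exp (c * s ^ 2) := by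
    have := Real.add_one_le_exp (c * s ^ 2); linarith
  rw [show -c * s ^ 2 = -(c * s ^ 2) by ring, Real.exp_neg, le_div_iff₀ (by positivity)]
  have h3 : 0 < Real.exp (c * s ^ 2) := Real.exp_pos _
  calc s * (Real.exp (c * s ^ 2))⁻¹ * (2 * Real.sqrt c) = (2 * Real.sqrt c * s) / Real.exp (c * s ^ 2) := by
        field_simp
    _ ≤ 1 := by rw [div_le_one h3]; linarith

/-- `s³ e^{−c s²} ≤ 2 c^{−3/2}` for `s ≥ 0`, `c > 0`. [folklore] -/
theorem pow_three_mul_exp_neg_mul_sq_le {s c : ℝ} (hs : 0 ≤ s) (hc : 0 < c) :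
    s ^ 3 * Real.exp (-c * s ^ 2) ≤ 2 * c ^ (-(3 / 2 : ℝ)) := by
  have hc32 : c ^ (-(3 / 2 : ℝ)) = 1 / (c * Real.sqrt c) := by
    rw [Real.rpow_neg hc.le, one_div]
    congr 1
    rw [show (3 / 2 : ℝ) = 1 + 1 / 2 by norm_num, Real.rpow_add hc, Real.rpow_one, Real.sqrt_eq_rpow]
  rw [hc32]
  have hsc : 0 < Real.sqrt c := Real.sqrt_pos.mpr hc
  have hcsq := Real.sq_sqrt hc.le
  rcases le_or_gt s (1 / Real.sqrt c) with hsmall | hbig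
  · -- `s³ ≤ c^{-3/2}` and `e^{-cs²} ≤ 1`
    have h1 : Real.exp (-c * s ^ 2) ≤ 1 := by
      rw [Real.exp_le_one_iff]; nlinarith
    have h2 : s ^ 3 ≤ 1 / (c * Real.sqrt c) := by
      have h3 : s ^ 3 ≤ (1 / Real.sqrt c) ^ 3 := pow_le_pow_left₀ hs hsmall 3
      refine h3.trans (le_of_eq ?_)
      rw [div_pow, one_pow, pow_succ, hcsq]
    have h4 : 0 ≤ 1 / (c * Real.sqrt c) := by positivity
    calc s ^ 3 * Real.exp (-c * s ^ 2) ≤ (1 / (c * Real.sqrt c)) * 1 :=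
          mul_le_mul h2 h1 (Real.exp_pos _).le h4
      _ ≤ 2 * (1 / (c * Real.sqrt c)) := by linarith
  · -- `e^{cs²} ≥ (cs²)²/2`, so `s³ e^{-cs²} ≤ 2/(c² s) ≤ 2 c^{-3/2}`
    have hs0 : 0 < s := lt_trans (by positivity) hbig
    have h1 : (c * s ^ 2) ^ 2 / 2 ≤ Real.exp (c * s ^ 2) := by
      have := Real.pow_div_factorial_le_exp (c * s ^ 2) (by positivity) 2
      simpa [Nat.factorial] using this
    rw [show -c * s ^ 2 = -(c * s ^ 2) by ring, Real.exp_neg]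
    have hexp0 : 0 < Real.exp (c * s ^ 2) := Real.exp_pos _
    rw [← div_eq_mul_inv, div_le_iff₀ hexp0]
    -- `s³ ≤ 2/(c√c) · (cs²)²/2 = c s⁴/√c · 1`, i.e. `√c ≤ c s` iff `s ≥ 1/√c`
    have h2 : s ^ 3 ≤ 2 * (1 / (c * Real.sqrt c)) * ((c * s ^ 2) ^ 2 / 2) := by
      have h3 : Real.sqrt c ≤ c * s := by
        rw [div_lt_iff₀ hsc] at hbig
        nlinarith
      have h4 : 2 * (1 / (c * Real.sqrt c)) * ((c * s ^ 2) ^ 2 / 2) = c * s ^ 4 / Real.sqrt c := by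
        field_simp
      rw [h4, le_div_iff₀ hsc]
      nlinarith [mul_le_mul_of_nonneg_left h3 (by positivity : 0 ≤ s ^ 3)]
    exact h2.trans (mul_le_mul_of_nonneg_left h1 (by positivity))

/-- `|t| e^{−(φ/2)t²} ≤ φ^{−1/2} e^{−(φ/4)t²}` and `|t|³ e^{−(φ/2)t²} ≤ 16 φ^{−3/2} e^{−(φ/4)t²}`. [folklore] -/
theorem abs_mul_gaussian_le {φ : ℝ} (hφ : 0 < φ) (t : ℝ) :
    |t| * Real.exp (-(φ / 2) * t ^ 2) ≤ (1 / Real.sqrt φ) * Real.exp (-(φ / 4) * t ^ 2) ∧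
    |t| ^ 3 * Real.exp (-(φ / 2) * t ^ 2) ≤ (16 * φ ^ (-(3 / 2 : ℝ))) * Real.exp (-(φ / 4) * t ^ 2) := by
  have hsplit : Real.exp (-(φ / 2) * t ^ 2) = Real.exp (-(φ / 4) * |t| ^ 2) * Real.exp (-(φ / 4) * t ^ 2) := by
    rw [← Real.exp_add, sq_abs]; congr 1; ring
  have h4 : (0 : ℝ) < φ / 4 := by positivity
  constructor
  · rw [hsplit, ← mul_assoc]
    apply mul_le_mul_of_nonneg_right _ (Real.exp_pos _).le
    have := mul_exp_neg_mul_sq_le |t| h4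
    refine this.trans (le_of_eq ?_)
    rw [show φ / 4 = φ / 2 ^ 2 by norm_num, Real.sqrt_div' _ (by norm_num : (0:ℝ) ≤ 2 ^ 2),
      Real.sqrt_sq (by norm_num : (0:ℝ) ≤ 2)]
    field_simp
  · rw [hsplit, ← mul_assoc]
    apply mul_le_mul_of_nonneg_right _ (Real.exp_pos _).le
    have := pow_three_mul_exp_neg_mul_sq_le (abs_nonneg t) h4
    refine this.trans (le_of_eq ?_)
    rw [Real.div_rpow hφ.le (by norm_num), Real.rpow_neg hφ.le, Real.rpow_neg (by norm_num : (0:ℝ) ≤ 4)]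
    have h16 : (4 : ℝ) ^ ((3 : ℝ) / 2) = 8 := by
      rw [show (4 : ℝ) = 2 ^ (2 : ℝ) by norm_num, ← Real.rpow_mul (by norm_num)]; norm_num
    rw [h16]; field_simp; norm_num

/-! ### The window -/

/-- **The window integral**: for `τ ≤ 1`, `13τ³ log y φ ≤ 1`, `α = α(x,y) ≥ 3/5`, `φ = φ₂(α,y) > 0`, a
continuous integrable kernel with `‖A t‖ ≤ B₀` and `‖A t − A 0‖ ≤ B₁|t|` on `|t| ≤ 1`:
`‖∫_{[-τ,τ]} f_A − A(0) ∫_{[-τ,τ]} e^{−φt²/2}‖ ≤ (1475 B₀ log y + 4 B₁)/φ`.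
[cite: HildebrandTenenbaum1986, §4 (Lemma 11)] -/
theorem norm_windowIntegral_sub_le {x τ B₀ B₁ : ℝ} {y : ℕ} {A : ℝ → ℂ} (hx : 1 < x) (hy : 2 ≤ y)
    (hα : 3 / 5 ≤ saddlePoint x y) (hτ1 : τ ≤ 1)
    (hη : 13 * τ ^ 3 * Real.log y * saddlePhi₂ (saddlePoint x y) y ≤ 1)
    (hφ0 : 0 < saddlePhi₂ (saddlePoint x y) y) (hA : Continuous A) (hAi : Integrable A)
    (hB₀ : 0 ≤ B₀) (hB₁ : 0 ≤ B₁)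
    (hB0 : ∀ t : ℝ, |t| ≤ 1 → ‖A t‖ ≤ B₀) (hB1 : ∀ t : ℝ, |t| ≤ 1 → ‖A t - A 0‖ ≤ B₁ * |t|) :
    ‖(∫ t in Icc (-τ) τ, kernelIntegrand x (saddlePoint x y) y A t) -
        A 0 * ∫ t in Icc (-τ) τ, (Real.exp (-(saddlePhi₂ (saddlePoint x y) y / 2) * t ^ 2) : ℂ)‖ ≤
      (1475 * B₀ * Real.log y + 4 * B₁) / saddlePhi₂ (saddlePoint x y) y := by
  set α : ℝ := saddlePoint x y with hαdef
  have hα0 : 0 < α := by linarith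
  set φ : ℝ := saddlePhi₂ α y with hφ
  have hlogy : 0 ≤ Real.log y := Real.log_nonneg (by exact_mod_cast le_trans one_le_two hy)
  -- integrability
  have hf : Integrable (kernelIntegrand x α y A) := integrable_kernelIntegrand hα0 x y hA hAi
  have hg : Integrable fun t : ℝ => (Real.exp (-(φ / 2) * t ^ 2) : ℂ) :=
    (integrable_exp_neg_mul_sq (by positivity : 0 < φ / 2)).ofReal
  have hsub : (∫ t in Icc (-τ) τ, kernelIntegrand x α y A t) -
      A 0 * ∫ t in Icc (-τ) τ, (Real.exp (-(φ / 2) * t ^ 2) : ℂ) =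
      ∫ t in Icc (-τ) τ, (kernelIntegrand x α y A t - A 0 * (Real.exp (-(φ / 2) * t ^ 2) : ℂ)) := by
    rw [integral_sub hf.integrableOn (hg.integrableOn.const_mul _), integral_const_mul]
  rw [hsub]
  -- the majorant `K e^{-(φ/4)t²}`
  set K : ℝ := (416 * B₀ * Real.log y + B₁) / Real.sqrt φ with hK
  have hsqφ : 0 < Real.sqrt φ := Real.sqrt_pos.mpr hφ0
  have hK0 : 0 ≤ K := by positivity
  have hBint : Integrable fun t : ℝ => K * Real.exp (-(φ / 4) * t ^ 2) :=
    (integrable_exp_neg_mul_sq (by positivity : 0 < φ / 4)).const_mul K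
  have hpt : ∀ t ∈ Icc (-τ) τ, ‖kernelIntegrand x α y A t - A 0 * (Real.exp (-(φ / 2) * t ^ 2) : ℂ)‖ ≤
      K * Real.exp (-(φ / 4) * t ^ 2) := by
    intro t ht
    have htabs : |t| ≤ τ := abs_le.mpr ⟨by linarith [ht.1], ht.2⟩
    have ht1 : |t| ≤ 1 := htabs.trans hτ1
    have h1 := norm_window_integrand_sub_le hx hy hα hη htabs (hB0 t ht1) (hB1 t ht1)
    rw [← hαdef, ← hφ] at h1
    refine h1.trans ?_
    obtain ⟨m1, m3⟩ := abs_mul_gaussian_le hφ0 t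
    have hφ32 : φ ^ (-(3 / 2 : ℝ)) = 1 / (φ * Real.sqrt φ) := by
      rw [Real.rpow_neg hφ0.le, show (3 / 2 : ℝ) = 1 + 1 / 2 by norm_num, Real.rpow_add hφ0, Real.rpow_one,
        ← Real.sqrt_eq_rpow, one_div]
    calc Real.exp (-(φ / 2) * t ^ 2) * (26 * B₀ * |t| ^ 3 * Real.log y * φ + B₁ * |t|)
        = 26 * B₀ * Real.log y * φ * (|t| ^ 3 * Real.exp (-(φ / 2) * t ^ 2)) +
            B₁ * (|t| * Real.exp (-(φ / 2) * t ^ 2)) := by ring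
      _ ≤ 26 * B₀ * Real.log y * φ * ((16 * φ ^ (-(3 / 2 : ℝ))) * Real.exp (-(φ / 4) * t ^ 2)) +
            B₁ * ((1 / Real.sqrt φ) * Real.exp (-(φ / 4) * t ^ 2)) :=
          add_le_add (mul_le_mul_of_nonneg_left m3 (by positivity)) (mul_le_mul_of_nonneg_left m1 hB₁)
      _ = K * Real.exp (-(φ / 4) * t ^ 2) := by
          rw [hK, hφ32]
          field_simp
          ring
  calc ‖∫ t in Icc (-τ) τ, (kernelIntegrand x α y A t - A 0 * (Real.exp (-(φ / 2) * t ^ 2) : ℂ))‖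
      ≤ ∫ t in Icc (-τ) τ, ‖kernelIntegrand x α y A t - A 0 * (Real.exp (-(φ / 2) * t ^ 2) : ℂ)‖ :=
        norm_integral_le_integral_norm _
    _ ≤ ∫ t in Icc (-τ) τ, K * Real.exp (-(φ / 4) * t ^ 2) :=
        setIntegral_mono_on ((hf.sub (hg.const_mul _)).norm.integrableOn) hBint.integrableOn measurableSet_Icc hpt
    _ ≤ ∫ t, K * Real.exp (-(φ / 4) * t ^ 2) :=
        setIntegral_le_integral hBint (Eventually.of_forall fun t => by positivity)
    _ = K * Real.sqrt (Real.pi / (φ / 4)) := by rw [integral_const_mul, integral_gaussian]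
    _ = (416 * B₀ * Real.log y + B₁) * (2 * Real.sqrt Real.pi) / φ := by
        rw [hK]
        have h4 : Real.sqrt (Real.pi / (φ / 4)) = 2 * Real.sqrt Real.pi / Real.sqrt φ := by
          rw [show Real.pi / (φ / 4) = Real.pi * 2 ^ 2 / φ by ring, Real.sqrt_div' _ hφ0.le,
            Real.sqrt_mul' _ (by norm_num), Real.sqrt_sq (by norm_num)]
          ring
        rw [h4]
        field_simp
        rw [Real.sq_sqrt hφ0.le]
    _ ≤ (1475 * B₀ * Real.log y + 4 * B₁) / φ := by
        apply div_le_div_of_nonneg_right _ hφ0.le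
        have hπ : Real.sqrt Real.pi ≤ 1.7725 := by
          rw [Real.sqrt_le_left (by norm_num)]
          have := Real.pi_lt_d6; nlinarith
        have hπ0 : 0 ≤ Real.sqrt Real.pi := Real.sqrt_nonneg _
        have h1 : 0 ≤ B₀ * Real.log y := by positivity
        nlinarith

/-! ### The tails -/

set_option maxHeartbeats 1000000 in
/-- **The tails off the window** (abstract kernel). Let `α = α(x,y) ∈ [3/5,1]`, `φ = φ₂(α,y) > 0`,
`τ = 100/√φ ≤ π/log y ≤ 1`, suppose the decay of `ζ(α+it,y)/ζ(α,y)`: `≤ ε₁` for `π/log y ≤ |t| ≤ 3` and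
`≤ ε₂` for `3 ≤ |t| ≤ T` (`T ≥ 3`), and a continuous integrable kernel with `‖A t‖ ≤ B₀` (`|t| ≤ 3`),
`‖A t‖ ≤ B_a` (all `t`), `‖A t‖ ≤ B₃/|t|³` (`|t| > T`). Then
`‖∫_{[-τ,τ]ᶜ} f_A‖ ≤ B₀ e^{−72} √(125π³/φ) + 10π ε₁ B₀/α + 2π ε₂ B_a T + 2π B₃/T²`.
[cite: HildebrandTenenbaum1986, §4 (Lemma 10)] -/
theorem norm_tailIntegral_le {x T ε₁ ε₂ B₀ Ba B₃ : ℝ} {y : ℕ} {A : ℝ → ℂ} (hy : 2 ≤ y)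
    (hα : 3 / 5 ≤ saddlePoint x y) (hα1 : saddlePoint x y ≤ 1) (hφ0 : 0 < saddlePhi₂ (saddlePoint x y) y)
    (hτ : 100 / Real.sqrt (saddlePhi₂ (saddlePoint x y) y) ≤ Real.pi / Real.log y)
    (hy1 : Real.pi / Real.log y ≤ 1) (hT : 3 ≤ T) (hε₁ : 0 ≤ ε₁) (hε₂ : 0 ≤ ε₂)
    (hdec1 : ∀ t : ℝ, Real.pi / Real.log y ≤ |t| → |t| ≤ 3 →
      ‖smoothZetaC ((saddlePoint x y : ℂ) + t * I) y‖ / smoothZeta (saddlePoint x y) y ≤ ε₁)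
    (hdec2 : ∀ t : ℝ, 3 ≤ |t| → |t| ≤ T →
      ‖smoothZetaC ((saddlePoint x y : ℂ) + t * I) y‖ / smoothZeta (saddlePoint x y) y ≤ ε₂)
    (hA : Continuous A) (hAi : Integrable A) (hB₀ : 0 ≤ B₀) (hBa : 0 ≤ Ba) (hB₃ : 0 ≤ B₃)
    (hB0 : ∀ t : ℝ, |t| ≤ 3 → ‖A t‖ ≤ B₀) (hBall : ∀ t : ℝ, ‖A t‖ ≤ Ba)
    (hB3 : ∀ t : ℝ, T < |t| → ‖A t‖ ≤ B₃ / |t| ^ 3) :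
    ‖∫ t in (Icc (-(100 / Real.sqrt (saddlePhi₂ (saddlePoint x y) y))) (100 / Real.sqrt (saddlePhi₂ (saddlePoint x y) y)))ᶜ,
        kernelIntegrand x (saddlePoint x y) y A t‖ ≤
      B₀ * Real.exp (-72) * Real.sqrt (125 * Real.pi ^ 3 / saddlePhi₂ (saddlePoint x y) y) +
        10 * Real.pi * ε₁ * B₀ / saddlePoint x y + 2 * Real.pi * ε₂ * Ba * T + 2 * Real.pi * B₃ / T ^ 2 := by
  set α : ℝ := saddlePoint x y with hαdef
  have hα0 : 0 < α := by linarith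
  set φ : ℝ := saddlePhi₂ α y with hφ
  set Φ : ℝ := Real.sqrt φ with hΦ
  have hΦ0 : 0 < Φ := Real.sqrt_pos.mpr hφ0
  have hΦsq : Φ ^ 2 = φ := Real.sq_sqrt hφ0.le
  set τ : ℝ := 100 / Φ with hτdef
  have hτ0 : 0 < τ := by positivity
  have hτ1 : τ ≤ 1 := hτ.trans hy1
  have hlogy0 : 0 < Real.log y := Real.log_pos (by exact_mod_cast lt_of_lt_of_le one_lt_two hy)
  have hT0 : 0 < T := by linarith
  -- the Gaussian rate `b = 2φ/(25π²)` and the majorant constants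
  set b : ℝ := 2 / (25 * Real.pi ^ 2) * φ with hb
  have hb0 : 0 < b := by have := Real.pi_pos; positivity
  have hbτ : b * τ ^ 2 = 800 / Real.pi ^ 2 := by
    rw [hb, hτdef, div_pow, hΦsq]; field_simp; ring
  have hbτ20 : 80 ≤ b * τ ^ 2 := by
    rw [hbτ, le_div_iff₀ (by positivity)]
    have := Real.pi_lt_d2; nlinarith [Real.pi_pos]
  set A' : ℝ := B₀ * Real.exp (-72) with hA'
  have hA'0 : 0 ≤ A' := by positivity
  set B : ℝ := ε₁ * B₀ * (α ^ 2 + 9) with hB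
  have hB0' : 0 ≤ B := by positivity
  set C : ℝ := 2 * ε₂ * Ba * T ^ 2 + 2 * B₃ / T with hC
  have hC0 : 0 ≤ C := by positivity
  -- ### the pointwise majorant off the window
  have hmaj : ∀ t, t ∉ Icc (-τ) τ → ‖kernelIntegrand x α y A t‖ ≤
      A' * Real.exp (-(b / 10) * t ^ 2) + B / (α ^ 2 + t ^ 2) + C / (T ^ 2 + t ^ 2) := by
    intro t ht
    have htabs : τ < |t| := by
      rw [mem_Icc, not_and_or, not_le, not_le] at ht
      rcases ht with h | h
      · rw [abs_of_neg (by linarith)]; linarith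
      · exact lt_of_lt_of_le h (le_abs_self t)
    have hnorm : ‖kernelIntegrand x α y A t‖ =
        ‖smoothZetaC ((α : ℂ) + t * I) y‖ / smoothZeta α y * ‖A t‖ := norm_kernelIntegrand_eq hα0 x y A t
    have hratio1 : ‖smoothZetaC ((α : ℂ) + t * I) y‖ / smoothZeta α y ≤ 1 := by
      rw [div_le_one (smoothZeta_pos hα0)]; exact norm_smoothZetaC_le hα0 t y
    have hratio0 : 0 ≤ ‖smoothZetaC ((α : ℂ) + t * I) y‖ / smoothZeta α y :=
      div_nonneg (norm_nonneg _) (smoothZeta_pos hα0).le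
    have h3terms : 0 ≤ A' * Real.exp (-(b / 10) * t ^ 2) ∧ 0 ≤ B / (α ^ 2 + t ^ 2) ∧ 0 ≤ C / (T ^ 2 + t ^ 2) :=
      ⟨by positivity, by positivity, by positivity⟩
    rcases le_or_gt |t| (Real.pi / Real.log y) with hI | hI
    · ---- region E4: `τ < |t| ≤ π/log y`: Gaussian decay of `ζ`, `‖A‖ ≤ B₀`
      have hgauss := norm_smoothZetaC_le_mul_exp_gaussian (le_trans (by norm_num) hα) (t := t) (y := y)
        (by rw [le_div_iff₀ hlogy0] at hI; linarith)
      have hW : ‖A t‖ ≤ B₀ := hB0 t (hI.trans (hy1.trans (by norm_num)))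
      -- the exponent is `-b t²` exactly (`φ₂` is that sum)
      have hexpo : -(2 / (25 * Real.pi ^ 2)) * t ^ 2 *
          ∑ p ∈ Nat.primesLE y, Real.log p ^ 2 * ((p : ℝ) ^ α / ((p : ℝ) ^ α - 1) ^ 2) = -b * t ^ 2 := by
        rw [hb, hφ, saddlePhi₂]; ring
      rw [hexpo] at hgauss
      have hrat : ‖smoothZetaC ((α : ℂ) + t * I) y‖ / smoothZeta α y ≤ Real.exp (-b * t ^ 2) := by
        rw [div_le_iff₀ (smoothZeta_pos hα0)]
        have := mul_comm (smoothZeta α y) (Real.exp (-b * t ^ 2))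
        linarith
      -- `e^{-bt²} ≤ e^{-72} e^{-(b/10)t²}` for `|t| ≥ τ`
      have hsplit : Real.exp (-b * t ^ 2) ≤ Real.exp (-72) * Real.exp (-(b / 10) * t ^ 2) := by
        rw [← Real.exp_add]
        apply Real.exp_le_exp.mpr
        have ht2 : τ ^ 2 ≤ t ^ 2 := by
          have h := pow_le_pow_left₀ hτ0.le htabs.le 2
          rwa [sq_abs] at h
        nlinarith
      calc ‖kernelIntegrand x α y A t‖ = ‖smoothZetaC ((α : ℂ) + t * I) y‖ / smoothZeta α y * ‖A t‖ := hnorm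
        _ ≤ (Real.exp (-72) * Real.exp (-(b / 10) * t ^ 2)) * B₀ :=
            mul_le_mul (hrat.trans hsplit) hW (norm_nonneg _) (by positivity)
        _ = A' * Real.exp (-(b / 10) * t ^ 2) := by rw [hA']; ring
        _ ≤ A' * Real.exp (-(b / 10) * t ^ 2) + B / (α ^ 2 + t ^ 2) + C / (T ^ 2 + t ^ 2) := by
            linarith [h3terms.2.1, h3terms.2.2]
    · rcases le_or_gt |t| 3 with hII | hII
      · ---- region E5: `π/log y < |t| ≤ 3`
        have hrat := hdec1 t hI.le hII
        have hW : ‖A t‖ ≤ B₀ := hB0 t hII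
        have hden : 1 ≤ (α ^ 2 + 9) / (α ^ 2 + t ^ 2) := by
          rw [le_div_iff₀ (by positivity)]
          have h9 : t ^ 2 ≤ 3 ^ 2 := by
            have h := pow_le_pow_left₀ (abs_nonneg t) hII 2
            rwa [sq_abs] at h
          linarith
        calc ‖kernelIntegrand x α y A t‖ = ‖smoothZetaC ((α : ℂ) + t * I) y‖ / smoothZeta α y * ‖A t‖ := hnorm
          _ ≤ ε₁ * B₀ := mul_le_mul hrat hW (norm_nonneg _) hε₁
          _ ≤ ε₁ * B₀ * ((α ^ 2 + 9) / (α ^ 2 + t ^ 2)) :=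
              le_mul_of_one_le_right (by positivity) hden
          _ = B / (α ^ 2 + t ^ 2) := by rw [hB]; field_simp
          _ ≤ A' * Real.exp (-(b / 10) * t ^ 2) + B / (α ^ 2 + t ^ 2) + C / (T ^ 2 + t ^ 2) := by
              linarith [h3terms.1, h3terms.2.2]
      · rcases le_or_gt |t| T with hIII | hIII
        · ---- region E6: `3 < |t| ≤ T`
          have hrat := hdec2 t hII.le hIII
          have hW : ‖A t‖ ≤ Ba := hBall t
          have hden : 1 ≤ 2 * T ^ 2 / (T ^ 2 + t ^ 2) := by
            rw [le_div_iff₀ (by positivity)]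
            have h9 : t ^ 2 ≤ T ^ 2 := by
              have h := pow_le_pow_left₀ (abs_nonneg t) hIII 2
              rwa [sq_abs] at h
            linarith
          calc ‖kernelIntegrand x α y A t‖ = ‖smoothZetaC ((α : ℂ) + t * I) y‖ / smoothZeta α y * ‖A t‖ := hnorm
            _ ≤ ε₂ * Ba := mul_le_mul hrat hW (norm_nonneg _) hε₂
            _ ≤ ε₂ * Ba * (2 * T ^ 2 / (T ^ 2 + t ^ 2)) := le_mul_of_one_le_right (by positivity) hden
            _ ≤ C / (T ^ 2 + t ^ 2) := by
                rw [← mul_div_assoc]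
                apply div_le_div_of_nonneg_right _ (by positivity)
                rw [hC]
                have : 0 ≤ 2 * B₃ / T := by positivity
                nlinarith
            _ ≤ A' * Real.exp (-(b / 10) * t ^ 2) + B / (α ^ 2 + t ^ 2) + C / (T ^ 2 + t ^ 2) := by
                linarith [h3terms.1, h3terms.2.1]
        · ---- region E7: `|t| > T`: the decay of `A`
          have habs0 : 0 < |t| := lt_trans hT0 hIII
          have hW' : ‖A t‖ ≤ B₃ / |t| ^ 3 := hB3 t hIII
          have hden : B₃ / |t| ^ 3 ≤ (2 * B₃ / T) / (T ^ 2 + t ^ 2) := by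
            -- `B₃ (T² + t²) T ≤ 2 B₃ |t|³` since `T² + t² ≤ 2t²` and `T t² ≤ |t| t²`
            have ht2 : T ^ 2 ≤ t ^ 2 := by
              have h := pow_le_pow_left₀ hT0.le hIII.le 2
              rwa [sq_abs] at h
            have h1 : |t| ^ 3 = |t| * t ^ 2 := by rw [← sq_abs]; ring
            have h2 : T * (T ^ 2 + t ^ 2) ≤ 2 * (|t| * t ^ 2) := by
              nlinarith [mul_le_mul hIII.le ht2 (by positivity) (abs_nonneg t),
                mul_le_mul_of_nonneg_right hIII.le (sq_nonneg t)]
            rw [div_div, div_le_div_iff₀ (by positivity) (by positivity), h1]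
            have := mul_le_mul_of_nonneg_left h2 hB₃
            nlinarith
          calc ‖kernelIntegrand x α y A t‖ = ‖smoothZetaC ((α : ℂ) + t * I) y‖ / smoothZeta α y * ‖A t‖ := hnorm
            _ ≤ 1 * (B₃ / |t| ^ 3) := mul_le_mul hratio1 hW' (norm_nonneg _) zero_le_one
            _ ≤ (2 * B₃ / T) / (T ^ 2 + t ^ 2) := by rw [one_mul]; exact hden
            _ ≤ C / (T ^ 2 + t ^ 2) := by
                apply div_le_div_of_nonneg_right _ (by positivity)
                rw [hC]; have : 0 ≤ 2 * ε₂ * Ba * T ^ 2 := by positivity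
                linarith
            _ ≤ A' * Real.exp (-(b / 10) * t ^ 2) + B / (α ^ 2 + t ^ 2) + C / (T ^ 2 + t ^ 2) := by
                linarith [h3terms.1, h3terms.2.1]
  -- ### integrate the majorant
  have htail := norm_setIntegral_compl_le measurableSet_Icc (integrable_kernelIntegrand hα0 x y hA hAi)
    (by positivity : 0 < b / 10) hα0 hT0 hA'0 hB0' hC0 hmaj
  refine htail.trans ?_
  have hπ0 := Real.pi_pos
  have e1 : Real.pi / (b / 10) = 125 * Real.pi ^ 3 / φ := by
    rw [hb]; field_simp; ring
  have t2 : B * Real.pi / α ≤ 10 * Real.pi * ε₁ * B₀ / α := by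
    have hB' : B ≤ 10 * ε₁ * B₀ := by
      rw [hB]
      have : α ^ 2 ≤ 1 := by nlinarith
      have h0 : 0 ≤ ε₁ * B₀ := by positivity
      nlinarith
    calc B * Real.pi / α ≤ (10 * ε₁ * B₀) * Real.pi / α := by
          apply div_le_div_of_nonneg_right _ hα0.le
          exact mul_le_mul_of_nonneg_right hB' hπ0.le
      _ = 10 * Real.pi * ε₁ * B₀ / α := by ring
  have t3 : C * Real.pi / T = 2 * Real.pi * ε₂ * Ba * T + 2 * Real.pi * B₃ / T ^ 2 := by
    rw [hC]; field_simp
  rw [e1, t3]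
  linarith [t2]

/-! ### Assembly -/

/-- The Gaussian window integral: `0 ≤ √(2π/φ) − ∫_{[-τ,τ]} e^{−φt²/2} ≤ e^{−φτ²/4} √(4π/φ)`. [folklore] -/
theorem gaussian_window {φ τ : ℝ} (hφ : 0 < φ) (hτ : 0 ≤ τ) :
    0 ≤ Real.sqrt (2 * Real.pi / φ) - ∫ t in Icc (-τ) τ, Real.exp (-(φ / 2) * t ^ 2) ∧
    Real.sqrt (2 * Real.pi / φ) - ∫ t in Icc (-τ) τ, Real.exp (-(φ / 2) * t ^ 2) ≤
      Real.exp (-(φ / 4) * τ ^ 2) * Real.sqrt (4 * Real.pi / φ) := by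
  set g : ℝ → ℝ := fun t => Real.exp (-(φ / 2) * t ^ 2) with hg
  have hgi : Integrable g := integrable_exp_neg_mul_sq (by positivity : 0 < φ / 2)
  have htot : (∫ t in Icc (-τ) τ, g t) + ∫ t in (Icc (-τ) τ)ᶜ, g t = Real.sqrt (2 * Real.pi / φ) := by
    rw [integral_add_compl measurableSet_Icc hgi]
    simp only [hg]
    rw [integral_gaussian]
    congr 1
    field_simp
  have htail0 : 0 ≤ ∫ t in (Icc (-τ) τ)ᶜ, g t :=
    integral_nonneg fun t => by simp only [hg]; positivity
  have hg4 : Integrable fun t : ℝ => Real.exp (-(φ / 4) * τ ^ 2) * Real.exp (-(φ / 4) * t ^ 2) :=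
    (integrable_exp_neg_mul_sq (by positivity : 0 < φ / 4)).const_mul _
  have htail : ∫ t in (Icc (-τ) τ)ᶜ, g t ≤ Real.exp (-(φ / 4) * τ ^ 2) * Real.sqrt (4 * Real.pi / φ) := by
    calc ∫ t in (Icc (-τ) τ)ᶜ, g t
        ≤ ∫ t in (Icc (-τ) τ)ᶜ, Real.exp (-(φ / 4) * τ ^ 2) * Real.exp (-(φ / 4) * t ^ 2) := by
          refine setIntegral_mono_on hgi.integrableOn hg4.integrableOn measurableSet_Icc.compl fun t ht => ?_
          simp only [hg]
          have ht2 : τ ^ 2 ≤ t ^ 2 := by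
            rw [mem_compl_iff, mem_Icc, not_and_or, not_le, not_le] at ht
            rcases ht with h | h
            · have h1 : τ < -t := by linarith
              have := mul_self_lt_mul_self hτ h1
              nlinarith
            · have := mul_self_lt_mul_self hτ h
              nlinarith
          rw [← Real.exp_add]
          exact Real.exp_le_exp.2 (by nlinarith)
      _ ≤ ∫ t, Real.exp (-(φ / 4) * τ ^ 2) * Real.exp (-(φ / 4) * t ^ 2) :=
          setIntegral_le_integral hg4 (Eventually.of_forall fun t => by positivity)
      _ = Real.exp (-(φ / 4) * τ ^ 2) * Real.sqrt (4 * Real.pi / φ) := by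
          rw [integral_const_mul, integral_gaussian]
          congr 2
          field_simp
  constructor <;> linarith

/-- `(x^α ζ/(2π)) √(2π/φ) = x^α ζ/√(2πφ)`. [folklore] -/
theorem main_const_identity {φ : ℝ} (hφ : 0 < φ) (M : ℝ) :
    M / (2 * Real.pi) * Real.sqrt (2 * Real.pi / φ) = M / Real.sqrt (2 * Real.pi * φ) := by
  have hπ := Real.pi_pos
  have h2π : 0 < 2 * Real.pi := by positivity
  have hs : Real.sqrt (2 * Real.pi / φ) = Real.sqrt (2 * Real.pi) / Real.sqrt φ := Real.sqrt_div' _ hφ.le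
  have hp : Real.sqrt (2 * Real.pi * φ) = Real.sqrt (2 * Real.pi) * Real.sqrt φ := Real.sqrt_mul h2π.le φ
  rw [hs, hp]
  have h1 : 0 < Real.sqrt (2 * Real.pi) := Real.sqrt_pos.mpr h2π
  have h3 : 0 < Real.sqrt φ := Real.sqrt_pos.mpr hφ
  have hsq : Real.sqrt (2 * Real.pi) ^ 2 = 2 * Real.pi := Real.sq_sqrt h2π.le
  rw [div_mul_div_comm, div_eq_div_iff (by positivity) (by positivity)]
  have e : M * Real.sqrt (2 * Real.pi) * (Real.sqrt (2 * Real.pi) * Real.sqrt φ) =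
      M * Real.sqrt (2 * Real.pi) ^ 2 * Real.sqrt φ := by ring
  rw [e, hsq]; ring

set_option maxHeartbeats 1000000 in
/-- **The saddle point with an abstract kernel.** Under the hypotheses of `norm_windowIntegral_sub_le`
and `norm_tailIntegral_le` (window `τ = 100/√φ`):
`‖∫ f_A − A(0)√(2π/φ)‖ ≤ (1475 B₀ log y + 4B₁)/φ + ‖A 0‖ e^{−φτ²/4}√(4π/φ) + B₀e^{−72}√(125π³/φ)`
`+ 10πε₁B₀/α + 2πε₂B_aT + 2πB₃/T²`. [cite: HildebrandTenenbaum1986, §4 (Lemmas 10–11)] -/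
theorem norm_kernelIntegral_sub_main_le {x T ε₁ ε₂ B₀ B₁ Ba B₃ : ℝ} {y : ℕ} {A : ℝ → ℂ} (hx : 1 < x) (hy : 2 ≤ y)
    (hα : 3 / 5 ≤ saddlePoint x y) (hα1 : saddlePoint x y ≤ 1) (hφ0 : 0 < saddlePhi₂ (saddlePoint x y) y)
    (hτ : 100 / Real.sqrt (saddlePhi₂ (saddlePoint x y) y) ≤ Real.pi / Real.log y)
    (hy1 : Real.pi / Real.log y ≤ 1)
    (hη : 13 * (100 / Real.sqrt (saddlePhi₂ (saddlePoint x y) y)) ^ 3 * Real.log y *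
      saddlePhi₂ (saddlePoint x y) y ≤ 1)
    (hT : 3 ≤ T) (hε₁ : 0 ≤ ε₁) (hε₂ : 0 ≤ ε₂)
    (hdec1 : ∀ t : ℝ, Real.pi / Real.log y ≤ |t| → |t| ≤ 3 →
      ‖smoothZetaC ((saddlePoint x y : ℂ) + t * I) y‖ / smoothZeta (saddlePoint x y) y ≤ ε₁)
    (hdec2 : ∀ t : ℝ, 3 ≤ |t| → |t| ≤ T →
      ‖smoothZetaC ((saddlePoint x y : ℂ) + t * I) y‖ / smoothZeta (saddlePoint x y) y ≤ ε₂)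
    (hA : Continuous A) (hAi : Integrable A) (hB₀ : 0 ≤ B₀) (hB₁ : 0 ≤ B₁) (hBa : 0 ≤ Ba) (hB₃ : 0 ≤ B₃)
    (hB0 : ∀ t : ℝ, |t| ≤ 3 → ‖A t‖ ≤ B₀) (hB1 : ∀ t : ℝ, |t| ≤ 1 → ‖A t - A 0‖ ≤ B₁ * |t|)
    (hBall : ∀ t : ℝ, ‖A t‖ ≤ Ba) (hB3 : ∀ t : ℝ, T < |t| → ‖A t‖ ≤ B₃ / |t| ^ 3) :
    ‖(∫ t, kernelIntegrand x (saddlePoint x y) y A t) -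
        A 0 * (Real.sqrt (2 * Real.pi / saddlePhi₂ (saddlePoint x y) y) : ℂ)‖ ≤
      (1475 * B₀ * Real.log y + 4 * B₁) / saddlePhi₂ (saddlePoint x y) y +
        ‖A 0‖ * (Real.exp (-(saddlePhi₂ (saddlePoint x y) y / 4) *
            (100 / Real.sqrt (saddlePhi₂ (saddlePoint x y) y)) ^ 2) *
          Real.sqrt (4 * Real.pi / saddlePhi₂ (saddlePoint x y) y)) +
        (B₀ * Real.exp (-72) * Real.sqrt (125 * Real.pi ^ 3 / saddlePhi₂ (saddlePoint x y) y) +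
          10 * Real.pi * ε₁ * B₀ / saddlePoint x y + 2 * Real.pi * ε₂ * Ba * T + 2 * Real.pi * B₃ / T ^ 2) := by
  set α : ℝ := saddlePoint x y with hαdef
  have hα0 : 0 < α := by linarith
  set φ : ℝ := saddlePhi₂ α y with hφ
  set Φ : ℝ := Real.sqrt φ with hΦ
  have hΦ0 : 0 < Φ := Real.sqrt_pos.mpr hφ0
  set τ : ℝ := 100 / Φ with hτdef
  have hτ0 : 0 < τ := by positivity
  have hτ1 : τ ≤ 1 := hτ.trans hy1
  have hf : Integrable (kernelIntegrand x α y A) := integrable_kernelIntegrand hα0 x y hA hAi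
  have hsplit : ∫ t, kernelIntegrand x α y A t =
      (∫ t in Icc (-τ) τ, kernelIntegrand x α y A t) + ∫ t in (Icc (-τ) τ)ᶜ, kernelIntegrand x α y A t :=
    (integral_add_compl measurableSet_Icc hf).symm
  have hwin := norm_windowIntegral_sub_le hx hy hα hτ1 hη hφ0 hA hAi hB₀ hB₁
    (fun t ht => hB0 t (ht.trans (by norm_num))) hB1
  have htail := norm_tailIntegral_le hy hα hα1 hφ0 hτ hy1 hT hε₁ hε₂ hdec1 hdec2 hA hAi hB₀ hBa hB₃ hB0 hBall hB3
  obtain ⟨hG0, hG1⟩ := gaussian_window hφ0 hτ0.le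
  rw [← hφ] at hwin htail
  rw [← hΦ] at htail
  rw [← hτdef] at htail
  set Gτ : ℝ := ∫ t in Icc (-τ) τ, Real.exp (-(φ / 2) * t ^ 2) with hGτ
  have hGτC : (∫ t in Icc (-τ) τ, (Real.exp (-(φ / 2) * t ^ 2) : ℂ)) = (Gτ : ℂ) := by
    rw [hGτ]; exact integral_ofReal
  rw [hGτC] at hwin
  rw [hsplit]
  set W := ∫ t in Icc (-τ) τ, kernelIntegrand x α y A t with hW
  set Tl := ∫ t in (Icc (-τ) τ)ᶜ, kernelIntegrand x α y A t with hTl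
  have halg : W + Tl - A 0 * (Real.sqrt (2 * Real.pi / φ) : ℂ) =
      (W - A 0 * (Gτ : ℂ)) + A 0 * (((Gτ - Real.sqrt (2 * Real.pi / φ) : ℝ)) : ℂ) + Tl := by
    push_cast; ring
  rw [halg]
  have hmid : ‖A 0 * (((Gτ - Real.sqrt (2 * Real.pi / φ) : ℝ)) : ℂ)‖ ≤
      ‖A 0‖ * (Real.exp (-(φ / 4) * τ ^ 2) * Real.sqrt (4 * Real.pi / φ)) := by
    rw [norm_mul, Complex.norm_real, Real.norm_eq_abs, abs_sub_comm, abs_of_nonneg hG0]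
    exact mul_le_mul_of_nonneg_left hG1 (norm_nonneg _)
  calc ‖(W - A 0 * (Gτ : ℂ)) + A 0 * (((Gτ - Real.sqrt (2 * Real.pi / φ) : ℝ)) : ℂ) + Tl‖
      ≤ ‖W - A 0 * (Gτ : ℂ)‖ + ‖A 0 * (((Gτ - Real.sqrt (2 * Real.pi / φ) : ℝ)) : ℂ)‖ + ‖Tl‖ := norm_add₃_le
    _ ≤ _ := add_le_add (add_le_add hwin hmid) htail

end SaddleKernel

end Literature.NumberTheory.Sieve

end
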